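import Summits.CriticalPhenomena.Ising3DConformalLimit.Theorems.MoebiusLimitExists.Negative.EtaExists
import Summits.CriticalPhenomena.Ising3DConformalLimit.Theorems.MoebiusLimitExists.Negative.InversionContent
import Summits.CriticalPhenomena.Ising3DConformalLimit.Theorems.LinkingParityCirclesSpinRatioMoebiusStubRatioOfCovariantFamily
import Mathlib.Geometry.Euclidean.Inversion.Basic
import HarnessLib

/-!
# Crux `LinkingParityCircles.SpinRatioMoebius` (stmt-CriticalPhenomena-4530), line `registered` —
# stub `stub_inversionCovariantOfInvariantRatios`: inversion covariance of the pinned limit from inversion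
# INVARIANCE of the pairing-ratio limits

Let `S : CorrFamily 3` be the pinned pointwise scaling limit of the critical `ℤ³` Ising correlators built
from the pairing-ratio limits `q`: on the non-coincidence locus
`S_{2m}(x) = q_{2m}(x) ∏_{j<m} ψ(x_{m+j} − x_j)`, off the locus `S = 0`, `S_2(a, b) = ψ(b − a)` for `a ≠ b`,
and `S` is `O(3)` invariant and scale covariant with dimension `Δ`.  If `q_{2m}` is INVARIANT under the unit
inversion `ι x = x/‖x‖²` on the locus (at configurations avoiding the origin), then `S` is inversion
COVARIANT with weight `Δ`: `S_n(ιx) = (∏ᵢ ‖xᵢ‖^{2Δ}) S_n(x)`.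

Mechanism.  `ι` is injective, so `ι ∘ x` is on the locus iff `x` is; off the locus both sides vanish, and
for odd `n` both sides vanish on the locus (`MoebiusLimitExistsNegative.limit_odd_eq_zero'`, `m*(β_c) = 0`).
For even `n = m + m` the ratio factor `q_{2m}` is invariant by hypothesis, and each two-point factor picks
up exactly its share of the weight: inversion covariance of the TWO-point function of an `O(3)`-invariant
scale-covariant pointwise limit is automatic (`MoebiusLimitExistsNegative.inversion_two_of_covariantLimit`:
`S_2(p, q) = A ‖p − q‖^{−2Δ}` and `‖ιp − ιq‖ = ‖p − q‖/(‖p‖‖q‖)`), whence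
`ψ(ιb − ιa) = ‖a‖^{2Δ} ‖b‖^{2Δ} ψ(b − a)`; the pairing `(j, m + j)` covers every index once
(`prod_pair_norms'`).

References: P. Di Francesco, P. Mathieu, D. Sénéchal, *Conformal Field Theory* (Springer 1997), §4.3.1,
eqs. (4.55), (4.62).
-/

noncomputable section

namespace Summit.CriticalPhenomena.Ising3DConformalLimit.Cruxes.SpinRatioMoebius.Birth

open Literature.Probability.LatticeModels EuclideanGeometry

/-- The two points of one pair of a non-coincident configuration are distinct (indices `j ≠ m + j`).
[folklore] -/
theorem invCov_pair_ne {m : ℕ} {x : Fin (m + m) → EuclideanSpace ℝ (Fin 3)}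
    (hx : x ∈ NonCoincident 3 (m + m)) (j : Fin m) : x (Fin.castAdd m j) ≠ x (Fin.natAdd m j) := by
  intro h
  have := congrArg Fin.val ((mem_nonCoincident x).1 hx h)
  simp only [Fin.val_castAdd, Fin.val_natAdd] at this
  omega

/-- **Each two-point factor picks up exactly its share of the inversion weight.** If
`S_2(a, b) = ψ(b − a)` (`a ≠ b`) for an `O(3)`-invariant, scale-covariant pointwise limit `S` of the
critical correlators on `ℤ³`, then `ψ(ιb − ιa) = ‖a‖^{2Δ} ‖b‖^{2Δ} ψ(b − a)` for distinct nonzero `a, b`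
(`ι` the unit inversion): inversion covariance of `S_2` is automatic
(`MoebiusLimitExistsNegative.inversion_two_of_covariantLimit`, from `‖ιb − ιa‖ = ‖b − a‖/(‖a‖‖b‖)`).
[cite: FrancescoMathieuSenechal1997, §4.3.1 eq. (4.55)] -/
theorem invCov_psi_pair {ρ : ℝ → ℝ} {Δ : ℝ} {ψ : EuclideanSpace ℝ (Fin 3) → ℝ} {S : CorrFamily 3}
    (hlim : HasPointwiseScalingLimit (criticalCorr 3) ρ S) (hsc : IsScaleCovariant Δ S)
    (hrot : IsRotationInvariant S)
    (hS2 : ∀ a b : EuclideanSpace ℝ (Fin 3), a ≠ b → S 2 ![a, b] = ψ (b - a))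
    {a b : EuclideanSpace ℝ (Fin 3)} (ha : a ≠ 0) (hb : b ≠ 0) (hab : a ≠ b) :
    ψ (inversion 0 1 b - inversion 0 1 a) = ‖a‖ ^ (2 * Δ) * ‖b‖ ^ (2 * Δ) * ψ (b - a) := by
  have hιab : inversion (0 : EuclideanSpace ℝ (Fin 3)) 1 a ≠ inversion 0 1 b :=
    fun h => hab (inversion_injective _ one_ne_zero h)
  have h0 : ∀ i, (![a, b] : Fin 2 → EuclideanSpace ℝ (Fin 3)) i ≠ 0 := fun i => by
    fin_cases i
    · exact ha
    · exact hb
  have h := MoebiusLimitExistsNegative.inversion_two_of_covariantLimit hlim hrot hsc ![a, b] h0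
    (pair_mem_nonCoincident hab)
  have hcfg : (fun i => inversion 0 1 ((![a, b] : Fin 2 → EuclideanSpace ℝ (Fin 3)) i)) =
      ![inversion 0 1 a, inversion 0 1 b] := by
    funext i; fin_cases i <;> rfl
  rw [hcfg, Fin.prod_univ_two, hS2 _ _ hιab, hS2 _ _ hab] at h
  simpa only [Matrix.cons_val_zero, Matrix.cons_val_one, Matrix.head_cons] using h

/-- **Stub `stub_inversionCovariantOfInvariantRatios` (inversion covariance of the pinned limit from
inversion INVARIANCE of the ratio limits).** For the pinned scaling limit `S`
(`S_{2m} = q_{2m} ∏_j ψ(x_{m+j} − x_j)` on the locus, `0` off it, `S_2(a,b) = ψ(b − a)`, `O(3)` invariant and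
scale covariant with `Δ`), inversion invariance of `q` on the locus gives `IsInversionCovariant Δ S`:
`‖ιb − ιa‖ = ‖b − a‖/(‖a‖‖b‖)` makes the two-point factors pick up exactly `∏_i ‖x_i‖^{2Δ}`
(`invCov_psi_pair`, `prod_pair_norms'`); odd orders vanish on the locus
(`MoebiusLimitExistsNegative.limit_odd_eq_zero'`), and everything vanishes off it.
[cite: FrancescoMathieuSenechal1997, §4.3.1 eq. (4.62)] -/
theorem stub_inversionCovariantOfInvariantRatios : ∀ (ρ : ℝ → ℝ) (Δ : ℝ) (ψ : EuclideanSpace ℝ (Fin 3) → ℝ) (S q : Literature.Probability.LatticeModels.CorrFamily 3), Literature.Probability.LatticeModels.HasPointwiseScalingLimit (Literature.Probability.LatticeModels.criticalCorr 3) ρ S → (∀ (n : ℕ) (z : Fin n → EuclideanSpace ℝ (Fin 3)), z ∉ Literature.Probability.LatticeModels.NonCoincident 3 n → S n z = 0) → Literature.Probability.LatticeModels.IsScaleCovariant Δ S → Literature.Probability.LatticeModels.IsRotationInvariant S → (∀ u : EuclideanSpace ℝ (Fin 3), u ≠ 0 → 0 < ψ u) → (∀ m : ℕ, ∀ x ∈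 Literature.Probability.LatticeModels.NonCoincident 3 (m + m), S (m + m) x = q (m + m) x * ∏ j : Fin m, ψ (x (Fin.natAdd m j) - x (Fin.castAdd m j))) → (∀ a b : EuclideanSpace ℝ (Fin 3), a ≠ b → S 2 ![a, b] = ψ (b - a)) → (∀ m : ℕ, ∀ x ∈ Literature.Probability.LatticeModels.NonCoincident 3 (m + m), (∀ i, x i ≠ 0) → q (m + m) (fun i => EuclideanGeometry.inversion 0 1 (x i)) = q (m + m) x) → Literature.Probability.LatticeModels.IsInversionCovariant Δ S := by
  intro ρ Δ ψ S q hlim hnorm hsc hrot _ hform hS2 hqinv n x hx0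
  -- the unit inversion is injective, so `ι ∘ x` is on the locus iff `x` is
  have hιiff : (fun i => inversion (0 : EuclideanSpace ℝ (Fin 3)) 1 (x i)) ∈ NonCoincident 3 n ↔
      x ∈ NonCoincident 3 n := by
    rw [mem_nonCoincident, mem_nonCoincident]
    exact (inversion_injective _ one_ne_zero).of_comp_iff x
  by_cases hx : x ∈ NonCoincident 3 n
  swap
  · -- off the locus both sides vanish
    rw [hnorm n _ (mt hιiff.1 hx), hnorm n x hx, mul_zero]
  have hιx := hιiff.2 hx
  rcases Nat.even_or_odd n with ⟨m, rfl⟩ | hodd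
  swap
  · -- odd order: both sides vanish on the locus
    rw [MoebiusLimitExistsNegative.limit_odd_eq_zero' hlim hodd hιx,
      MoebiusLimitExistsNegative.limit_odd_eq_zero' hlim hodd hx, mul_zero]
  -- even order `m + m`: the ratio factor is invariant, the two-point factors carry the weight
  have hpair : ∀ j : Fin m,
      ψ (inversion 0 1 (x (Fin.natAdd m j)) - inversion 0 1 (x (Fin.castAdd m j))) =
        ‖x (Fin.castAdd m j)‖ ^ (2 * Δ) * ‖x (Fin.natAdd m j)‖ ^ (2 * Δ) *
          ψ (x (Fin.natAdd m j) - x (Fin.castAdd m j)) := fun j =>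
    invCov_psi_pair hlim hsc hrot hS2 (hx0 _) (hx0 _) (invCov_pair_ne hx j)
  calc S (m + m) (fun i => inversion 0 1 (x i))
      = q (m + m) x * ∏ j : Fin m,
          ψ (inversion 0 1 (x (Fin.natAdd m j)) - inversion 0 1 (x (Fin.castAdd m j))) := by
        rw [← hqinv m x hx hx0]
        exact hform m _ hιx
    _ = q (m + m) x * ∏ j : Fin m, (‖x (Fin.castAdd m j)‖ ^ (2 * Δ) * ‖x (Fin.natAdd m j)‖ ^ (2 * Δ) *
          ψ (x (Fin.natAdd m j) - x (Fin.castAdd m j))) := by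
        rw [Finset.prod_congr rfl fun j _ => hpair j]
    _ = (∏ i, ‖x i‖ ^ (2 * Δ)) *
          (q (m + m) x * ∏ j : Fin m, ψ (x (Fin.natAdd m j) - x (Fin.castAdd m j))) := by
        rw [Finset.prod_mul_distrib, prod_pair_norms']
        ring
    _ = (∏ i, ‖x i‖ ^ (2 * Δ)) * S (m + m) x := by rw [hform m x hx]

end Summit.CriticalPhenomena.Ising3DConformalLimit.Cruxes.SpinRatioMoebius.Birth

end
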